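import Literature.Analysis.OperatorTheory.CompactNearIdentityFiniteDim
import Mathlib.Algebra.Polynomial.Div
import Mathlib.RingTheory.Polynomial.Basic
import HarnessLib

/-!
# Bounds for symmetric and skew-symmetric operators on vectors annihilated by a polynomial

Topic `Literature/Analysis/OperatorTheory`; sequel of `CompactNearIdentityFiniteDim`
(`norm_apply_le_rootSum_of_isSymmetric`: a symmetric operator on a FINITE-dimensional complex inner
product space with `P(A) = 0` satisfies `‖A v‖ ≤ Λ_P ‖v‖`, `Λ_P = ∑_{roots P} |λ|`). Here the
finite-dimensionality is moved from the space to the vector: on an arbitrary (possibly incomplete)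
complex inner product space `E`, a symmetric (resp. skew-symmetric) everywhere-defined operator `T`
and a vector `v` with `P(T) v = 0` for a non-zero polynomial `P` satisfy `‖T v‖ ≤ Λ ‖v‖` with `Λ`
depending on `P` only:

* `exists_finiteDimensional_invariant_of_aeval_apply_eq_zero` — the cyclic subspace
  `ℂ[T] v = {Q(T) v}` is finite-dimensional (it is spanned by the `Q(T) v`, `deg Q < deg P`, by
  division with remainder), contains `v`, is `T`-stable and is killed by `P(T)` (pure algebra, any
  module);
* `norm_apply_le_rootSum_of_symmetric_of_aeval_apply_eq_zero` — **symmetric case**: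
  `‖T v‖ ≤ Λ_P ‖v‖` (restrict `T` to the cyclic subspace and apply the finite-dimensional bound),
  and `norm_inner_le_rootSum_of_symmetric_of_aeval_apply_eq_zero` (`|⟪T v, v⟫| ≤ Λ_P ‖v‖²`);
* `norm_apply_le_rootSum_of_skew_of_aeval_apply_eq_zero` — **skew-symmetric case**: `i T` is
  symmetric and is annihilated on the cyclic subspace by `P(-i X)`, so `‖T v‖ ≤ Λ_{P(-iX)} ‖v‖`.

This is the form in which the Casimir operator (symmetric) and the `𝔨`-derivatives (skew) of a
`Z(𝔤)`-finite `K`-finite vector are bounded uniformly over all the vectors a fixed pair of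
polynomials annihilates (Harish-Chandra 1953, §11; Borel 1997, §8–9). Everything is proved; there are
no definitions.

## References

* A. Borel, *Automorphic forms on `SL₂(ℝ)`*, Cambridge Tracts in Math. 130 (1997), Thm. 8.5, 9.5–9.6
  [Borel1997].
* Harish-Chandra, *Representations of a semisimple Lie group on a Banach space. I*, Trans. AMS 75
  (1953), §11 [HarishChandraTAMS1953].
-/

open Polynomial Module
open scoped InnerProductSpace ComplexConjugate

namespace Literature.Analysis.OperatorTheory

/-! ### The cyclic subspace of a vector annihilated by a polynomial -/

section Cyclic

variable {M : Type*} [AddCommGroup M] [Module ℂ M]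

/-- **The cyclic subspace of an algebraic vector is finite-dimensional.** Let `T` be an endomorphism
of a complex vector space `M`, `P ≠ 0` a polynomial and `v` a vector with `P(T) v = 0`. Then there is a
finite-dimensional subspace `V ∋ v` which is stable under `T` and on which `P(T)` vanishes: the
cyclic subspace `{Q(T) v | Q ∈ ℂ[X]}`, which is spanned by the `Q(T) v` with `deg Q < deg P` (write
`Q = (Q mod P̃) + P̃ · (Q div P̃)` for the monic normalisation `P̃` of `P`). [folklore] -/
theorem exists_finiteDimensional_invariant_of_aeval_apply_eq_zero (T : Module.End ℂ M) {P : ℂ[X]}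
    (hP : P ≠ 0) {v : M} (hv : aeval T P v = 0) :
    ∃ V : Submodule ℂ M, FiniteDimensional ℂ V ∧ v ∈ V ∧ (∀ w ∈ V, T w ∈ V) ∧
      ∀ w ∈ V, aeval T P w = 0 := by
  -- the evaluation map `Q ↦ Q(T) v`
  let ev : ℂ[X] →ₗ[ℂ] M := LinearMap.applyₗ v ∘ₗ (aeval T).toLinearMap
  have hev : ∀ Q : ℂ[X], ev Q = aeval T Q v := fun Q => rfl
  -- the monic normalisation of `P`
  set c : ℂ := P.leadingCoeff with hc
  have hc0 : c ≠ 0 := leadingCoeff_ne_zero.2 hP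
  set P' : ℂ[X] := P * C c⁻¹ with hP'
  have hP'm : P'.Monic := by
    rw [hP', Monic, leadingCoeff_mul, leadingCoeff_C, hc, mul_inv_cancel₀ hc0]
  have hP'v : aeval T P' v = 0 := by
    rw [hP', map_mul, Module.End.mul_apply, aeval_C, Module.algebraMap_end_apply, map_smul, hv,
      smul_zero]
  have hdeg : P'.natDegree = P.natDegree := by
    rw [hP', natDegree_mul hP (by simpa using inv_ne_zero hc0), natDegree_C, add_zero]
  -- reduction modulo `P'`
  have hred : ∀ Q : ℂ[X], aeval T Q v = aeval T (Q %ₘ P') v := by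
    intro Q
    conv_lhs => rw [← modByMonic_add_div Q P']
    rw [map_add, LinearMap.add_apply, map_mul, Module.End.mul_apply]
    have : aeval T (Q /ₘ P') (aeval T P' v) = 0 := by rw [hP'v, map_zero]
    rw [show aeval T P' (aeval T (Q /ₘ P') v) = aeval T (Q /ₘ P') (aeval T P' v) by
      rw [← Module.End.mul_apply, ← map_mul, mul_comm, map_mul, Module.End.mul_apply], this, add_zero]
  refine ⟨LinearMap.range ev, ?_, ?_, ?_, ?_⟩
  · -- finite-dimensional: the range is the image of the polynomials of degree `< deg P`
    have hle : LinearMap.range ev ≤ (degreeLT ℂ P.natDegree).map ev := by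
      rintro _ ⟨Q, rfl⟩
      refine ⟨Q %ₘ P', ?_, ?_⟩
      · change Q %ₘ P' ∈ degreeLT ℂ P.natDegree
        rw [mem_degreeLT, ← hdeg]
        exact (degree_modByMonic_lt Q hP'm).trans_le degree_le_natDegree
      · rw [hev, hev, ← hred]
    haveI : FiniteDimensional ℂ (degreeLT ℂ P.natDegree) :=
      LinearEquiv.finiteDimensional (degreeLTEquiv ℂ P.natDegree).symm
    exact Submodule.finiteDimensional_of_le hle
  · -- `v = 1(T) v`
    exact ⟨1, by rw [hev, map_one, Module.End.one_apply]⟩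
  · -- `T`-stable: `T (Q(T) v) = (X Q)(T) v`
    rintro _ ⟨Q, rfl⟩
    refine ⟨X * Q, ?_⟩
    rw [hev, hev, map_mul, Module.End.mul_apply, aeval_X]
  · -- killed by `P(T)`
    rintro _ ⟨Q, rfl⟩
    rw [hev, ← Module.End.mul_apply, ← map_mul, mul_comm, map_mul, Module.End.mul_apply, hv, map_zero]

end Cyclic

/-! ### Symmetric and skew-symmetric operators -/

section InnerProduct

variable {E : Type*} [NormedAddCommGroup E] [InnerProductSpace ℂ E]

/-- Restricting `P(T)` to a `T`-stable subspace. [folklore] -/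
theorem coe_aeval_restrict_apply (T : E →ₗ[ℂ] E) {V : Submodule ℂ E} (hV : ∀ w ∈ V, T w ∈ V)
    (P : ℂ[X]) (x : V) : ((aeval (T.restrict hV) P x : V) : E) = aeval T P x := by
  rw [aeval_endomorphism, aeval_endomorphism]
  simp only [Polynomial.sum, Submodule.coe_sum, Submodule.coe_smul]
  refine Finset.sum_congr rfl fun i _ => ?_
  rw [Module.End.pow_restrict i hV, LinearMap.restrict_apply]

/-- **Symmetric case.** Let `T` be an everywhere-defined symmetric operator on a complex inner product
space (`⟪T x, y⟫ = ⟪x, T y⟫`), `P ≠ 0`, and `v` with `P(T) v = 0`. Then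
`‖T v‖ ≤ (∑_{λ ∈ roots P} |λ|) ‖v‖`: restrict `T` to the finite-dimensional cyclic subspace of `v`
(`exists_finiteDimensional_invariant_of_aeval_apply_eq_zero`) and apply
`norm_apply_le_rootSum_of_isSymmetric`. Borel 1997, Thm. 9.5–9.6; Harish-Chandra 1953, §11 (the
Casimir operator on a `Z(𝔤)`-finite vector). [folklore] -/
theorem norm_apply_le_rootSum_of_symmetric_of_aeval_apply_eq_zero (T : E →ₗ[ℂ] E)
    (hT : ∀ x y : E, ⟪T x, y⟫_ℂ = ⟪x, T y⟫_ℂ) {P : ℂ[X]} (hP : P ≠ 0) {v : E}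
    (hv : aeval T P v = 0) : ‖T v‖ ≤ (P.roots.map fun z => ‖z‖).sum * ‖v‖ := by
  obtain ⟨V, hVfd, hvV, hVT, hVP⟩ := exists_finiteDimensional_invariant_of_aeval_apply_eq_zero T hP hv
  haveI : FiniteDimensional ℂ V := hVfd
  set A : V →ₗ[ℂ] V := T.restrict hVT with hA_def
  have hA : A.IsSymmetric := fun x y => by
    rw [Submodule.coe_inner, Submodule.coe_inner, hA_def, LinearMap.restrict_apply,
      LinearMap.restrict_apply]
    exact hT x y
  have hPA : aeval A P = 0 := by
    refine LinearMap.ext fun x => Subtype.ext ?_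
    rw [hA_def, coe_aeval_restrict_apply T hVT P x, LinearMap.zero_apply, Submodule.coe_zero]
    exact hVP x x.2
  have h := norm_apply_le_rootSum_of_isSymmetric hA hP hPA ⟨v, hvV⟩
  rwa [hA_def, Submodule.coe_norm, Submodule.coe_norm, LinearMap.restrict_apply] at h

/-- **Symmetric case, quadratic form**: `|⟪T v, v⟫| ≤ (∑_{roots P} |λ|) ‖v‖²`. [folklore] -/
theorem norm_inner_le_rootSum_of_symmetric_of_aeval_apply_eq_zero (T : E →ₗ[ℂ] E)
    (hT : ∀ x y : E, ⟪T x, y⟫_ℂ = ⟪x, T y⟫_ℂ) {P : ℂ[X]} (hP : P ≠ 0) {v : E}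
    (hv : aeval T P v = 0) : ‖⟪T v, v⟫_ℂ‖ ≤ (P.roots.map fun z => ‖z‖).sum * ‖v‖ ^ 2 := by
  calc ‖⟪T v, v⟫_ℂ‖ ≤ ‖T v‖ * ‖v‖ := norm_inner_le_norm _ _
    _ ≤ (P.roots.map fun z => ‖z‖).sum * ‖v‖ * ‖v‖ :=
        mul_le_mul_of_nonneg_right
          (norm_apply_le_rootSum_of_symmetric_of_aeval_apply_eq_zero T hT hP hv) (norm_nonneg _)
    _ = (P.roots.map fun z => ‖z‖).sum * ‖v‖ ^ 2 := by ring

/-- The substitution `X ↦ -i X` does not kill a non-zero polynomial. [folklore] -/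
theorem comp_C_neg_I_mul_X_ne_zero {P : ℂ[X]} (hP : P ≠ 0) : P.comp (C (-Complex.I) * X) ≠ 0 := by
  intro h
  rcases comp_eq_zero_iff.1 h with h1 | ⟨-, h2⟩
  · exact hP h1
  · have h3 := congrArg (fun q : ℂ[X] => q.coeff 1) h2
    simp only [coeff_C_mul, coeff_X_one, mul_one, coeff_C_succ] at h3
    exact (neg_ne_zero.2 Complex.I_ne_zero) h3

/-- **Skew-symmetric case.** Let `T` be an everywhere-defined skew-symmetric operator on a complex
inner product space (`⟪T x, y⟫ = -⟪x, T y⟫`), `P ≠ 0`, and `v` with `P(T) v = 0`. Then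
`‖T v‖ ≤ (∑_{λ ∈ roots P(-iX)} |λ|) ‖v‖`: `i T` is symmetric and `P(-i X)` annihilates it on the cyclic
subspace of `v`. Harish-Chandra 1953, §11 (the `𝔨`-derivatives of a unitary representation are skew
and act through finitely many weights on a `K`-finite vector). [folklore] -/
theorem norm_apply_le_rootSum_of_skew_of_aeval_apply_eq_zero (T : E →ₗ[ℂ] E)
    (hT : ∀ x y : E, ⟪T x, y⟫_ℂ = -⟪x, T y⟫_ℂ) {P : ℂ[X]} (hP : P ≠ 0) {v : E}
    (hv : aeval T P v = 0) :
    ‖T v‖ ≤ ((P.comp (C (-Complex.I) * X)).roots.map fun z => ‖z‖).sum * ‖v‖ := by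
  obtain ⟨V, hVfd, hvV, hVT, hVP⟩ := exists_finiteDimensional_invariant_of_aeval_apply_eq_zero T hP hv
  haveI : FiniteDimensional ℂ V := hVfd
  set B : V →ₗ[ℂ] V := T.restrict hVT with hB_def
  set A : V →ₗ[ℂ] V := (Complex.I : ℂ) • B with hA_def
  have hA : A.IsSymmetric := fun x y => by
    rw [hA_def, LinearMap.smul_apply, LinearMap.smul_apply, inner_smul_left, inner_smul_right,
      Submodule.coe_inner, Submodule.coe_inner, hB_def, LinearMap.restrict_apply,
      LinearMap.restrict_apply, hT, Complex.conj_I]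
    ring
  set Q : ℂ[X] := P.comp (C (-Complex.I) * X) with hQ_def
  have hQ : Q ≠ 0 := comp_C_neg_I_mul_X_ne_zero hP
  have hBP : aeval B P = 0 := by
    refine LinearMap.ext fun x => Subtype.ext ?_
    rw [hB_def, coe_aeval_restrict_apply T hVT P x, LinearMap.zero_apply, Submodule.coe_zero]
    exact hVP x x.2
  have hQA : aeval A Q = 0 := by
    have hsub : aeval A (C (-Complex.I) * X) = B := by
      rw [map_mul, aeval_C, aeval_X, Algebra.algebraMap_eq_smul_one, smul_mul_assoc, one_mul,
        hA_def, smul_smul, neg_mul, Complex.I_mul_I, neg_neg, one_smul]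
    rw [hQ_def, aeval_comp, hsub, hBP]
  have h := norm_apply_le_rootSum_of_isSymmetric hA hQ hQA ⟨v, hvV⟩
  rw [hA_def, LinearMap.smul_apply, norm_smul, Complex.norm_I, one_mul, hB_def, Submodule.coe_norm,
    Submodule.coe_norm, LinearMap.restrict_apply] at h
  exact h

end InnerProduct

end Literature.Analysis.OperatorTheory
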